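import Summits.ResolutionOfSingularities.ResolutionOfSingularities.Theorems.HilbertSamuelEliminationSigmaMaxModificationsCorridor3WLadderIsoRestartSim
import Literature.AlgebraicGeometry.Resolution.NormalCrossingsLocal
import Literature.AlgebraicGeometry.Resolution.ComponentGluing
import Literature.AlgebraicGeometry.Resolution.BlowupReducedDimension
import Literature.AlgebraicGeometry.Resolution.BlowupsLocal
import Literature.AlgebraicGeometry.Resolution.AlterationsNormalFormStrictTransform
import HarnessLib

/-!
# [OURS · L1 W4.2] D8-S1 file 7: the HISTORY RELATION along the global run and the simulation state at the RESTART STAGE `m = 0`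
# (crux chain w42, v7/v8.1 stub `stub_isoOpenRestartLocal` ⟸ `LocalRunSimulationM p`; hand res-D-pv-060)

OURS plumbing (cell `res-hironaka`, slot W4.2, crux `stmt-ResolutionOfSingularities-18506` / conjunct `-19249`; `--supports … --as helper`,
counted 0); NOT statements of the manuscript under review [claim: Hironaka2017, status: under-review] nor of [CossartJannsenSaito2020] (POINTER:
Thm. 1.2, Rem. 6.29 (1)). AI plumbing, weaker than expert review.

(i) `HistRel` holds for the pending cycle of every stage REACHED from an initial marked stage (`histRel_of_reaches`): it is born at a cycle
start (the oracle names the replayed sequence on the reduced part itself) and survives every replay step — a Cartier-trivial open piece of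
`Bl_D(S)` misses the exceptional divisor (an effective Cartier divisor pulls back to an effective Cartier divisor along an open immersion),
so it maps by an open immersion to `S` off `V(D)` (`isOpenImmersion_comp_of_disjoint`, GW Prop. 13.91 (3)) and the head `D` is pruned away.
(ii) A reduced scheme with at most one point is Cartier-trivial (`cartierTrivial_of_subsingleton`: the local equation is a non-zero-divisor
of a reduced ring with a single prime, hence a unit); so is the reduced closed point `V(𝓘_{pt})`. (iii) `SimRel.init`: at a stage `s` under
the cycle invariant with the history relation, for a POINTED open `U ∋ s.pt` (`U(ν) = {s.pt}`), the initial marked stage of `U` is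
simulation-related to `s` along `U ↪ s.W`: the only component of `Y_s` meeting `U` is `{s.pt}`; a pending cycle whose part misses `U` gives
state (b), otherwise state (c) with the open piece of the replayed subscheme identified with `V(𝓘_{pt})` (Mathlib `IsClosedImmersion.lift`,
tree `ker_eq_vanishingIdeal_range`) and the oracle's answer supplied by the history through LOCALITY of the oracle. [folklore]
-/

noncomputable section

set_option linter.dupNamespace false -- mandated namespace of this single-conjunct summit

open CategoryTheory CategoryTheory.Limits AlgebraicGeometry TopologicalSpace
open Summit.ResolutionOfSingularities.ResolutionOfSingularities.Theorems.CampaignW42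
open Literature.AlgebraicGeometry.Resolution Literature.RingTheory.HilbertSamuel
open Literature.AlgebraicGeometry.CossartJannsenSaito2020
open Summit.ResolutionOfSingularities.ResolutionOfSingularities.Theorems.SigmaMaxModificationsCorridor3
open Summit.ResolutionOfSingularities.ResolutionOfSingularities.Theorems.SigmaMaxModificationsCorridor3.Moving
open Summit.ResolutionOfSingularities.ResolutionOfSingularities.Theorems.SigmaMaxModificationsCorridor3.Helpers (QPointed)

universe u

namespace Summit.ResolutionOfSingularities.ResolutionOfSingularities.Cruxes.SigmaMaxModifications.IdeasL1Idea2R4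

variable {R : ∀ S : Scheme.{u}, CentreSeq S → Prop} {N : ℕ} {ν : ℕ → ℕ}

/-! ## §4. The history relation along the global run -/

section History

/-- **An open immersion into a blow-up that misses the centre composes with the blow-down to an open immersion** (the blow-up is an
isomorphism over the complement of the centre, GW Prop. 13.91 (3)). [cite: GortzWedhorn2020, Prop. 13.91 (3)] -/
theorem isOpenImmersion_comp_of_disjoint {S S' V : Scheme.{u}} {π : S' ⟶ S} {D : S.IdealSheafData} (hπ : IsBlowup π D)
    (g : V ⟶ S') [IsOpenImmersion g] (h : Disjoint (Set.range (g ≫ π).base) (D.support : Set S)) :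
    IsOpenImmersion (g ≫ π) := by
  let O : S.Opens := ⟨(D.support : Set S)ᶜ, D.support.isClosed.isOpen_compl⟩
  have hiso : IsIso (π ∣_ O) := hπ.isIso_morphismRestrict (U := O) disjoint_compl_left
  haveI := isOpenImmersion_ι_comp_of_isIso_morphismRestrict π O hiso
  have hsub : Set.range g.base ⊆ Set.range (π ⁻¹ᵁ O).ι.base := by
    rw [Scheme.Opens.range_ι]
    rintro _ ⟨v, rfl⟩
    show π.base (g.base v) ∈ (D.support : Set S)ᶜ
    exact Set.disjoint_left.mp h ⟨v, (Scheme.Hom.comp_apply g π v)⟩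
  have hfac : IsOpenImmersion.lift (π ⁻¹ᵁ O).ι g hsub ≫ ((π ⁻¹ᵁ O).ι ≫ π) = g ≫ π := by
    rw [← Category.assoc, IsOpenImmersion.lift_fac]
  haveI : IsOpenImmersion (IsOpenImmersion.lift (π ⁻¹ᵁ O).ι g hsub) := by
    have : IsOpenImmersion (IsOpenImmersion.lift (π ⁻¹ᵁ O).ι g hsub ≫ (π ⁻¹ᵁ O).ι) := by
      rw [IsOpenImmersion.lift_fac]; infer_instance
    exact IsOpenImmersion.of_comp _ (π ⁻¹ᵁ O).ι
  rw [← hfac]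
  infer_instance

variable {W : Scheme.{u}}

/-- **The history relation survives a replay step** (and is born at a cycle start): a Cartier-trivial open piece of `Bl_D(S)` misses the
exceptional divisor `D·𝒪_{Bl}` (an effective Cartier divisor pulls back to an effective Cartier divisor along an open immersion), so it
maps by an open immersion to `S`, off `V(D)`, where the history of `S` applies; the head `D` is pruned away
(`prune_comap_cons_eq_of_lift`). [cite: GortzWedhorn2020, Prop. 13.91 (3)] -/
theorem histRel_of_isReplayStep {S : Scheme.{u}} [IsLocallyNoetherian S] [IsReduced S] {L : Labelling W} {Y : Set W} {j : ℕ}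
    {φ : S ⟶ W} {D : S.IdealSheafData} {t₁ : CentreSeq (blowup D)} {C : W.IdealSheafData} {P' : Option (Pending (blowup C))}
    (hrs : IsReplayStep L Y j φ (CentreSeq.cons D t₁) C P')
    (hnamed : ∃ (S₀ : Scheme.{u}) (t₀ : CentreSeq S₀) (f : S ⟶ S₀), R S₀ t₀ ∧
      ∀ (V : Scheme.{u}) (g : V ⟶ S), IsOpenImmersion g → CartierTrivial V →
        IsOpenImmersion (g ≫ f) ∧ (t₀.comap (g ≫ f)).prune = ((CentreSeq.cons D t₁).comap g).prune) :
    ∀ Q', P' = some Q' → HistRel R Q' := by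
  obtain ⟨-, φ', hφ', -, rfl⟩ := hrs
  rintro Q' hQ'
  obtain rfl := Option.some_injective _ hQ'
  obtain ⟨S₀, t₀, f, hR₀, hall⟩ := hnamed
  refine ⟨(blowup.isBlowup D).isReduced_of_isReduced, S₀, t₀, blowup.π D ≫ f, hR₀, fun V g' hg' hV => ?_⟩
  haveI := hg'
  -- `g'` misses the exceptional divisor
  have hE : (D.comap (blowup.π D)).comap g' = ⊤ :=
    hV _ ((blowup.isBlowup D).isEffectiveCartier.comap_of_isOpenImmersion g')
  have hdisj : Disjoint (Set.range (g' ≫ blowup.π D).base) (D.support : Set S) := by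
    rw [comap_eq_top_iff_disjoint, Scheme.IdealSheafData.support_comap] at hE
    refine Set.disjoint_left.mpr ?_
    rintro _ ⟨v, rfl⟩ hv
    refine Set.disjoint_left.mp hE ⟨v, rfl⟩ ?_
    rw [Closeds.coe_preimage, Set.mem_preimage, ← Scheme.Hom.comp_apply]
    exact hv
  haveI : IsOpenImmersion (g' ≫ blowup.π D) := isOpenImmersion_comp_of_disjoint (blowup.isBlowup D) g' hdisj
  have hDg : D.comap (g' ≫ blowup.π D) = ⊤ := (comap_eq_top_iff_disjoint _ D).mpr hdisj
  obtain ⟨ho, heq⟩ := hall V (g' ≫ blowup.π D) inferInstance hV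
  refine ⟨by simpa only [Category.assoc] using ho, ?_⟩
  show (t₀.comap (g' ≫ blowup.π D ≫ f)).prune = (t₁.comap g').prune
  rw [← Category.assoc, heq, prune_comap_cons_eq_of_lift D t₁ hDg rfl]

variable [IsLocallyNoetherian W] {L : Labelling W} {C : W.IdealSheafData} {P' : Option (Pending (blowup C))}

/-- **At a cycle start the history relation is born**: the new pending cycle replays the tail of the sequence `t` that the oracle names
on the reduced part `V(𝓘_T)` itself (`f = 𝟙`). [cite: CossartJannsenSaito2020, Rem. 6.29 (1)] -/
theorem histRel_of_isCanonicalStep_none (hcs : IsCanonicalStep R N ν L none C P') : ∀ Q', P' = some Q' → HistRel R Q' := by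
  obtain ⟨j, hj, hcl, t, hRt, hrs⟩ := hcs
  cases t with
  | nil _ =>
    obtain ⟨-, rfl⟩ := hrs
    intro Q' h
    cases h
  | cons D t₁ =>
    haveI : IsLocallyNoetherian (Scheme.IdealSheafData.vanishingIdeal
        (⟨L.part (Scheme.hsStratum W N ν) j, hcl⟩ : Closeds W)).subscheme :=
      LocallyOfFiniteType.isLocallyNoetherian (Scheme.IdealSheafData.vanishingIdeal
        (⟨L.part (Scheme.hsStratum W N ν) j, hcl⟩ : Closeds W)).subschemeι
    haveI : IsReduced (Scheme.IdealSheafData.vanishingIdeal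
        (⟨L.part (Scheme.hsStratum W N ν) j, hcl⟩ : Closeds W)).subscheme :=
      ComponentGluing.isReduced_subscheme_vanishingIdeal _
    refine histRel_of_isReplayStep hrs ⟨_, _, 𝟙 _, hRt, fun V g hg hV => ⟨?_, ?_⟩⟩
    · rw [Category.comp_id]; exact hg
    · rw [Category.comp_id]

/-- **Inside a cycle the history relation propagates.** [cite: CossartJannsenSaito2020, Rem. 6.29 (1)] -/
theorem histRel_of_isCanonicalStep_some {P : Pending W} (hP : HistRel R P) (hcs : IsCanonicalStep R N ν L (some P) C P') :
    ∀ Q', P' = some Q' → HistRel R Q' := by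
  haveI := P.isClosedImmersion
  haveI : IsLocallyNoetherian P.src := LocallyOfFiniteType.isLocallyNoetherian P.hom
  haveI := hP.isReduced
  obtain ⟨-, hrs⟩ := hcs
  obtain ⟨S₀, t₀, f, hR₀, hall⟩ := hP.named
  rcases hr : P.rest with _ | ⟨D, t₁⟩
  · rw [hr] at hrs
    obtain ⟨-, rfl⟩ := hrs
    intro Q' h
    cases h
  · rw [hr] at hrs hall
    exact histRel_of_isReplayStep hrs ⟨S₀, t₀, f, hR₀, hall⟩

end History

/-- **The history relation along canonical near steps** … [folklore] -/
theorem histRel_of_canonicalNearStep {s s' : MarkedStage.{u}} (hH : ∀ Q, s.P = some Q → HistRel R Q)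
    (hst : CanonicalNearStep R N ν s s') : ∀ Q', s'.P = some Q' → HistRel R Q' := by
  obtain ⟨C, P', hln, x', hcs, -, -, -, rfl⟩ := hst
  haveI : IsLocallyNoetherian s.W := s.ln
  rcases hsP : s.P with _ | P
  · rw [hsP] at hcs; exact histRel_of_isCanonicalStep_none hcs
  · rw [hsP] at hcs; exact histRel_of_isCanonicalStep_some (hH P hsP) hcs

/-- **… and along `Reaches` from an initial stage** (where no cycle is pending). [folklore] -/
theorem histRel_of_reaches {X : Scheme.{u}} [IsLocallyNoetherian X] {x : X} {s : MarkedStage.{u}}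
    (hs : Reaches R N ν (MarkedStage.init X x) s) : ∀ Q, s.P = some Q → HistRel R Q := by
  induction hs with
  | refl => intro Q h; cases h
  | tail _ hlast ih => exact histRel_of_canonicalNearStep ih hlast

/-! ## §5. Cartier-trivial: reduced schemes with one point; the simulation state at the restart stage -/

/-- **A reduced scheme with at most one point is Cartier-trivial**: on the affine open around the point the local equation of an
effective Cartier divisor is a non-zero-divisor of a reduced ring with a single prime ideal, hence a unit. [folklore] -/
theorem cartierTrivial_of_subsingleton {V : Scheme.{u}} [IsReduced V] (hV : Subsingleton V) : CartierTrivial V := by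
  intro I hI
  rw [← Scheme.IdealSheafData.support_eq_bot_iff, eq_bot_iff]
  intro v hv
  exfalso
  obtain ⟨W, hvW, f, hf, hIW⟩ := hI v
  -- the ring of sections on `W` has a single prime ideal
  have huniq : ∀ p q : PrimeSpectrum Γ(V, W), p = q := fun p q =>
    W.2.fromSpec.isOpenEmbedding.injective (Subsingleton.elim _ _)
  have hunit : IsUnit f := by
    by_contra hnu
    obtain ⟨m, hm, hfm⟩ := Ideal.exists_le_maximal (Ideal.span {f}) (by rwa [Ne, Ideal.span_singleton_eq_top])
    haveI : Nontrivial Γ(V, W) := by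
      by_contra ht
      rw [not_nontrivial_iff_subsingleton] at ht
      exact hm.ne_top (Subsingleton.elim _ _)
    have hnil : f ∈ nilradical Γ(V, W) := by
      rw [nilradical_eq_sInf, Ideal.mem_sInf]
      intro p hp
      have hpm : (⟨p, hp⟩ : PrimeSpectrum Γ(V, W)) = ⟨m, hm.isPrime⟩ := huniq _ _
      have hpm' : p = m := by simpa using congrArg PrimeSpectrum.asIdeal hpm
      rw [hpm']
      exact hfm (Ideal.mem_span_singleton_self f)
    have hf0 : f = 0 := (mem_nilradical.mp hnil).eq_zero
    rw [hf0] at hf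
    exact zero_notMem_nonZeroDivisors hf
  have htop : I.ideal W = ⊤ := by
    rw [hIW, Ideal.span_singleton_eq_top]; exact hunit
  rw [Scheme.IdealSheafData.mem_support_iff_of_mem (U := W) hvW, htop] at hv
  have h1 := (Scheme.mem_zeroLocus_iff _ _ _).mp hv 1 Submodule.mem_top
  rw [Scheme.basicOpen_one] at h1  -- hmm name?
  exact h1 hvW


/-- The reduced closed subscheme on a single point is Cartier-trivial. [folklore] -/
theorem cartierTrivial_subscheme_vanishingIdeal_singleton {V : Scheme.{u}} (v : V) (hv : IsClosed ({v} : Set V)) :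
    CartierTrivial (Scheme.IdealSheafData.vanishingIdeal (⟨{v}, hv⟩ : Closeds V)).subscheme := by
  haveI := ComponentGluing.isReduced_subscheme_vanishingIdeal (⟨{v}, hv⟩ : Closeds V)
  refine cartierTrivial_of_subsingleton ⟨fun a b => ?_⟩
  apply (Scheme.IdealSheafData.vanishingIdeal (⟨{v}, hv⟩ : Closeds V)).subschemeι.isClosedEmbedding.injective
  have hr : ∀ c, (Scheme.IdealSheafData.vanishingIdeal (⟨{v}, hv⟩ : Closeds V)).subschemeι.base c = v := fun c => by
    have : (Scheme.IdealSheafData.vanishingIdeal (⟨{v}, hv⟩ : Closeds V)).subschemeι.base c ∈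
        Set.range (Scheme.IdealSheafData.vanishingIdeal (⟨{v}, hv⟩ : Closeds V)).subschemeι.base := ⟨c, rfl⟩
    rw [Scheme.IdealSheafData.range_subschemeι, Scheme.IdealSheafData.coe_support_vanishingIdeal] at this
    exact this
  rw [hr a, hr b]

/-! ## §6. The simulation state at the restart stage `m = 0` -/

section Init

variable {k k' : Type u} [Field k] [Field k'] {s : MarkedStage.{u}}

/-- **THE START OF THE SIMULATION.** At a stage `s` under the cycle invariant, with closed marked point in the stratum and the history
relation for its pending cycle (both hold at every stage reached from a maximal origin), and for an open `U ∋ s.pt` which is POINTED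
(`U(ν) = {s.pt}`) and carries the cycle invariant at its initial marked stage: the initial stage `MarkedStage.init U s.pt` is simulation-
related to `s` along `U ↪ s.W`. Labels: the only component of `Y_s` meeting `U` is `{s.pt}` (a component meeting `U` is the closure of its
trace `⊆ {s.pt}`). Pending cycle: if its part misses `U`, state (b); else state (c) with the open piece of the replayed subscheme
identified with the reduced point `V(𝓘_{{pt}})` (reduced closed subschemes with the same support) and the oracle's answer supplied by the
history relation through the LOCAL oracle. [cite: CossartJannsenSaito2020, Thm. 1.2, Rem. 6.29 (1)] -/
theorem SimRel.init (hRl : OracleLocal R) (hs : CycleInv k R N ν s) (hptcl : IsClosed ({s.pt} : Set s.W)) (hH : ∀ Q, s.P = some Q → HistRel R Q) (U : s.W.Opens)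
    (hU : IsLocallyNoetherian (U : Scheme.{u})) (h₀ : s.pt ∈ U)
    (hUpt : QPointed N ν (U : Scheme.{u}) ⟨s.pt, h₀⟩)
    (hUcyc : CycleInv k' R N ν (@MarkedStage.init (U : Scheme.{u}) hU ⟨s.pt, h₀⟩)) :
    SimRel k' R N ν s (@MarkedStage.init (U : Scheme.{u}) hU ⟨s.pt, h₀⟩) U.ι := by
  haveI : IsLocallyNoetherian s.W := s.ln
  have hYU : U.ι.base ⁻¹' Scheme.hsStratum s.W N ν = Scheme.hsStratum (U : Scheme.{u}) N ν :=
    Scheme.preimage_hsStratum_of_isOpenImmersion U.ι N ν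
  -- the only component of `Y_s` meeting `U` is `{s.pt}`
  have hcomp : ∀ ⦃Z : Set s.W⦄, Z ∈ componentsIn (Scheme.hsStratum s.W N ν) → (Z ∩ Set.range U.ι.base).Nonempty → Z = {s.pt} := by
    intro Z hZ hne
    have hZU : Z ∩ Set.range U.ι.base ⊆ {s.pt} := by
      rintro z ⟨hzZ, y, rfl⟩
      have hy : y ∈ Scheme.hsStratum (U : Scheme.{u}) N ν := by
        rw [← hYU, Set.mem_preimage]; exact componentsIn.subset hZ hzZ
      rw [show Scheme.hsStratum (U : Scheme.{u}) N ν = _ from hUpt] at hy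
      rw [hy]
      rfl
    have hZsub : Z ⊆ {s.pt} := by
      refine (subset_closure_inter_of_isPreirreducible_of_isOpen (componentsIn.isIrreducible hZ).2
        U.ι.isOpenEmbedding.isOpen_range hne).trans ?_
      exact (closure_mono hZU).trans hptcl.closure_subset
    exact (Set.subset_singleton_iff_eq.mp hZsub).resolve_left (componentsIn.isIrreducible hZ).1.ne_empty
  refine ⟨(inferInstance : IsOpenImmersion U.ι), rfl, hUcyc, ?_, ?_⟩
  · exact LabelRel.of_forall_eq (fun Z₁ hZ₁ hne₁ Z₂ hZ₂ hne₂ => by rw [hcomp hZ₁ hne₁, hcomp hZ₂ hne₂]) _ _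
  · show PendRel R N ν U.ι (Labelling.init (U : Scheme.{u})) s.P none
    rcases hsP : s.P with _ | P
    · exact pendRel_none_none _ _
    · haveI := P.isClosedImmersion
      by_cases hdisj : Disjoint (Set.range P.hom.base) (Set.range U.ι.base)
      · exact Or.inl hdisj
      refine Or.inr ?_
      obtain ⟨hrangeP, -, -, -⟩ := hs.pending P hsP
      have hH₀ := hH P hsP
      haveI := hH₀.isReduced
      -- the least label of the fresh run is `0`, its part is `U(ν) = {pt}`
      have hpart0 : (Labelling.init (U : Scheme.{u})).part (Scheme.hsStratum (U : Scheme.{u}) N ν) 0 = {⟨s.pt, h₀⟩} := by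
        rw [Labelling.init_part_zero]; exact hUpt
      have hjU : IsLeast {i | ((Labelling.init (U : Scheme.{u})).part (Scheme.hsStratum (U : Scheme.{u}) N ν) i).Nonempty} 0 :=
        ⟨by rw [Set.mem_setOf_eq, hpart0]; exact Set.singleton_nonempty _, fun i _ => Nat.zero_le i⟩
      have hptclU : IsClosed ({⟨s.pt, h₀⟩} : Set (U : Scheme.{u})) := by
        have : ({⟨s.pt, h₀⟩} : Set (U : Scheme.{u})) = U.ι.base ⁻¹' {s.pt} := by
          ext y
          simp only [Set.mem_singleton_iff, Set.mem_preimage]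
          constructor
          · rintro rfl; rfl
          · intro hy; exact Subtype.ext hy
        rw [this]
        exact hptcl.preimage U.ι.continuous
      have hclU : IsClosed ((Labelling.init (U : Scheme.{u})).part (Scheme.hsStratum (U : Scheme.{u}) N ν) 0) := by
        rw [hpart0]; exact hptclU
      -- the open piece of the replayed subscheme
      have Hsq := (isPullback_morphismRestrict P.hom U).flip
      haveI : IsClosedImmersion (P.hom ∣_ U) := MorphismProperty.of_isPullback Hsq inferInstance
      have hrangeφ : Set.range (P.hom ∣_ U).base =
          (Labelling.init (U : Scheme.{u})).part (Scheme.hsStratum (U : Scheme.{u}) N ν) 0 := by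
        rw [range_snd_eq_preimage_range_of_isPullback Hsq, hpart0]
        refine Set.Subset.antisymm ?_ ?_
        · intro y hy
          have : y ∈ Scheme.hsStratum (U : Scheme.{u}) N ν := by
            rw [← hYU, Set.mem_preimage]
            rw [Set.mem_preimage, hrangeP] at hy
            exact s.L.part_subset _ _ hy
          rwa [show Scheme.hsStratum (U : Scheme.{u}) N ν = _ from hUpt] at this
        · obtain ⟨w, hwP, y, rfl⟩ := Set.not_disjoint_iff.mp hdisj
          have hy : y ∈ Scheme.hsStratum (U : Scheme.{u}) N ν := by
            rw [← hYU, Set.mem_preimage]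
            rw [hrangeP] at hwP
            exact s.L.part_subset _ _ hwP
          rw [show Scheme.hsStratum (U : Scheme.{u}) N ν = _ from hUpt] at hy
          have hy' : y = ⟨s.pt, h₀⟩ := hy
          rw [Set.singleton_subset_iff, Set.mem_preimage, ← hy']
          exact hwP
      have hker : (P.hom ∣_ U).ker = (Scheme.IdealSheafData.vanishingIdeal
          ⟨(Labelling.init (U : Scheme.{u})).part (Scheme.hsStratum (U : Scheme.{u}) N ν) 0, hclU⟩).subschemeι.ker := by
        rw [Scheme.IdealSheafData.ker_subschemeι, ker_eq_vanishingIdeal_range (P.hom ∣_ U) (hrangeφ ▸ hclU)]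
        congr 1
        ext1
        exact hrangeφ
      set e := IsClosedImmersion.lift (P.hom ∣_ U) (Scheme.IdealSheafData.vanishingIdeal
          ⟨(Labelling.init (U : Scheme.{u})).part (Scheme.hsStratum (U : Scheme.{u}) N ν) 0, hclU⟩).subschemeι hker.le with he
      haveI : IsIso e := IsClosedImmersion.isIso_lift _ _ hker
      have hefac : e ≫ (P.hom ∣_ U) = (Scheme.IdealSheafData.vanishingIdeal
          ⟨(Labelling.init (U : Scheme.{u})).part (Scheme.hsStratum (U : Scheme.{u}) N ν) 0, hclU⟩).subschemeι :=
        IsClosedImmersion.lift_fac _ _ _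
      have HsqJ : IsPullback (e ≫ (P.hom ⁻¹ᵁ U).ι) (Scheme.IdealSheafData.vanishingIdeal
          ⟨(Labelling.init (U : Scheme.{u})).part (Scheme.hsStratum (U : Scheme.{u}) N ν) 0, hclU⟩).subschemeι P.hom U.ι := by
        refine Hsq.of_iso (asIso e).symm (Iso.refl _) (Iso.refl _) (Iso.refl _) ?_ ?_ ?_ ?_
        all_goals simp [hefac]
      -- Cartier-triviality of the reduced point, and the oracle's answer from the history
      have hCT : CartierTrivial (Scheme.IdealSheafData.vanishingIdeal
          (⟨(Labelling.init (U : Scheme.{u})).part (Scheme.hsStratum (U : Scheme.{u}) N ν) 0, hclU⟩ : Closeds U)).subscheme := by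
        have heq : (⟨(Labelling.init (U : Scheme.{u})).part (Scheme.hsStratum (U : Scheme.{u}) N ν) 0, hclU⟩ : Closeds U) =
            ⟨{⟨s.pt, h₀⟩}, hptclU⟩ := Closeds.ext hpart0
        rw [heq]
        exact cartierTrivial_subscheme_vanishingIdeal_singleton _ hptclU
      obtain ⟨S₀, t₀, f, hR₀, hall⟩ := hH₀.named
      obtain ⟨ho, heq⟩ := hall _ (e ≫ (P.hom ⁻¹ᵁ U).ι) inferInstance hCT
      haveI := ho
      refine ⟨0, hclU, e ≫ (P.hom ⁻¹ᵁ U).ι, hjU, inferInstance, HsqJ, ?_⟩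
      have := hRl ((e ≫ (P.hom ⁻¹ᵁ U).ι) ≫ f) t₀ hR₀
      rwa [CentreSeq.restrict_eq_comap, heq] at this

end Init


end Summit.ResolutionOfSingularities.ResolutionOfSingularities.Cruxes.SigmaMaxModifications.IdeasL1Idea2R4

end
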